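import Literature.NumberTheory.LFunctions.NymanBeurlingVectorsNorms
import Mathlib.Analysis.SpecialFunctions.Integrals.Basic
import Mathlib.MeasureTheory.Integral.IntervalIntegral.IntegrationByParts
import HarnessLib

/-!
# Burnol's higher vectors `Y^λ_{ρ,k}` (`k < m_ρ`) on the Mellin side — definitions and bounds

Continuation of `Literature/NumberTheory/LFunctions/NymanBeurlingVectors.lean` (the `k = 0` vectors
behind the tree's proof of the BDBLS bound, `Literature.Barriers.RiemannHypothesis.BDBLS2000_thm_holds`).
For Burnol 2002, Theorem 1.3 (`liminf D(λ)√(log(1/λ)) ≥ √(∑_ρ m_ρ²/|ρ|²)`, the tree's named fact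
`Literature.Barriers.RiemannHypothesis.Burnol2002_thm1_3`, proved in
`Literature/Barriers/RiemannHypothesis/NymanBeurlingObstructionsBurnolProofs.lean`) one needs, for
a zero `ρ` of `ζ` on the critical line of multiplicity `m_ρ`, the whole family `Y^λ_{ρ,k}`,
`0 ≤ k < m_ρ` (Burnol, Thm. 4.2 and Definition 5.1: `Y^λ_{s,k} = lim_{w→s} V⁻¹Q_λV(ψ_{w,k})`,
`ψ_{w,k}(t) = (log(1/t))^k t^{-w} χ(t)`). As for `k = 0` we realise a variant of these vectors
through explicit Mellin data on the critical line `s = 1/2 + iτ`. With `u = s - ρ`,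
`L = log(1/λ) = Lof λ`, `W(s) = V(s)/V(ρ)` (`V = burnolV`, `|W| = 1` on the line, `W(ρ) = 1`) and
`r = burnolR`:

* `phiK k z = k! (e^z ∑_{i ≤ k} (-z)^i/i! - 1)/z^{k+1}`, with `Φ_k(z) = (-1)^k ∫_0^1 x^k e^{zx} dx`
  (`phiK_eq_integral`), so that `L^{k+1} Φ_k(Lu) = (-1)^k ∫_0^L y^k e^{uy} dy` is the Mellin-side
  shadow of `ψ_{ρ,k}` truncated at `λ`; the envelope `‖Φ_k(iy)‖ ≤ min(1, 2/|y|)` and the recurrence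
  `z Φ_{k+1}(z) = (k+1) Φ_k(z) + (-1)^{k+1} e^z`;
* `dsl f a n` — iterated divided differences, with the exact Taylor formula
  `f(s) = ∑_{j<n} c_j (s-a)^j + (s-a)^n (dsl f a n)(s)` (`taylor_dsl`), analyticity
  (`analyticOnNhd_dsl`) and the identification `dsl f a n = f/(s-a)^n` when `f` vanishes to order
  `n` (`dsl_eq_div`);
* `TW ρ k`, `Zk ρ k` — Taylor polynomial and analytic (hence `λ`-independent, bounded on the line)
  remainder of `W` at `ρ`;
* `burnolKk ρ k λ s = -r(s) (k! Z_k(s) + W(s) L^{k+1} Φ_k(L(s-ρ)))`, equivalently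
  `k! r(s) (T_k[W](s) - (V(s)/V(ρ)) λ^{ρ-s} T_k(-L(s-ρ)))/(s-ρ)^{k+1}`
  (`burnolKk_eq_pole_expansion`), a finite combination of `r(s)/(s-ρ)^n` and
  `(V(s)/V(ρ)) λ^{ρ-s} r(s)/(s-ρ)^n`, `1 ≤ n ≤ k+1`; `burnolKk ρ 0 λ = -burnolK ρ λ` (`burnolKk_zero`).

Main results here: boundedness of `Z_k` on the line (`exists_norm_Zk_line_le`), the pointwise bounds
`‖K_k‖ ≤ ‖r‖ (k! D + L^{k+1})` and `‖K_k‖ ≤ ‖r‖ (k! D + 2L^k/|τ-γ|)` (`norm_burnolKk_line_le`) and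
`K_k ∈ L¹ ∩ L²` on the line (`integrable_burnolKk_line`). The file also fixes the vocabulary
used by the two companion files and by
`Literature/Barriers/RiemannHypothesis/NymanBeurlingObstructionsBurnolProofs.lean`: the kernels
`partRn`, `qRn`, `partLn`, `qLn` of the orthogonality argument (general pole order `n`, through
`dsl ζ₁ ρ n`), the scaled model `Mk`, the monomials `fMon k = 𝟙_{[0,1]} x^k` and Gram kernel
`gramKer` of the asymptotics, and the vectors themselves:
`burnolX λ ρ k = burnolCoef ρ k λ · 𝓜⁻¹(conj ∘ burnolKk (1/2 + i im ρ) k λ)` with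
`burnolCoef = ε_ρ(-1)^k/(√w(im ρ) L^k √L)`, `ε_ρ = burnolPhase ρ = -conj(ρ)³/|ρ|³` (a variant of
Burnol's `X^λ_{ρ,k} = (log(1/λ))^{-1/2-k} Y^λ_{ρ,k}`, Definition 5.1). Orthogonality to `𝓑_λ` is in
`NymanBeurlingVectorsHigherOrthogonal.lean`, the asymptotics of pairings and Gram matrix in
`NymanBeurlingVectorsHigherAsymptotics.lean`.

## References

* J.-F. Burnol, *A lower bound in an approximation problem involving the zeros of the Riemann
  zeta function*, Adv. Math. 170 (2002), 56–70; arXiv:math/0103058, §4 (`ψ_{w,k}`, Thm. 4.2,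
  Cor. 4.3), §5 (Definition 5.1, Thm. 5.2).
-/

noncomputable section

open Complex Filter MeasureTheory Set Finset
open scoped Real Topology ComplexConjugate Nat

namespace Literature.NumberTheory.LFunctions

namespace BurnolVectors

/-! ## 1. The model function `Φ_k(z) = k! (e^z ∑_{i ≤ k} (-z)^i/i! - 1) / z^{k+1}` -/

/-- The truncated exponential series `T_k(z) = ∑_{i ≤ k} z^i/i!`. [folklore] -/
def expTrunc (k : ℕ) (z : ℂ) : ℂ :=
  ∑ i ∈ Finset.range (k + 1), z ^ i / i !

/-- The model function `Φ_k(z) = k! · (e^z T_k(-z) - 1) / z^{k+1}` (junk value `0` at `z = 0`); for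
`z = uL` it is `L^{-k-1}` times the Mellin-side model `(-1)^k ∫_0^L x^k e^{ux} dx` of Burnol's
`k`-th vector (`ψ_{w,k} = (log(1/t))^k t^{-w} χ(t)` on the logarithmic scale). [cite: Burnol2002, §4 (ψ_{w,k}) and Thm. 5.2 (proof)] -/
def phiK (k : ℕ) (z : ℂ) : ℂ :=
  k ! * (Complex.exp z * expTrunc k (-z) - 1) / z ^ (k + 1)

/-- `T_0 = 1`. [folklore] -/
@[simp] theorem expTrunc_zero (z : ℂ) : expTrunc 0 z = 1 := by
  simp [expTrunc]

/-- `T_{k+1}(z) = T_k(z) + z^{k+1}/(k+1)!`. [folklore] -/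
theorem expTrunc_succ (k : ℕ) (z : ℂ) :
    expTrunc (k + 1) z = expTrunc k z + z ^ (k + 1) / (k + 1)! := by
  rw [expTrunc, Finset.sum_range_succ, expTrunc]

/-- `Φ_0(z) = (e^z - 1)/z`. [folklore] -/
theorem phiK_zero (z : ℂ) : phiK 0 z = (Complex.exp z - 1) / z := by
  simp [phiK]

/-- **The recurrence `z Φ_{k+1}(z) = (k+1) Φ_k(z) + (-1)^{k+1} e^z`** (`z ≠ 0`). [folklore] -/
theorem mul_phiK_succ {z : ℂ} (hz : z ≠ 0) (k : ℕ) :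
    z * phiK (k + 1) z = (k + 1) * phiK k z + (-1) ^ (k + 1) * Complex.exp z := by
  have hk : ((k ! : ℕ) : ℂ) ≠ 0 := by exact_mod_cast (Nat.factorial_pos k).ne'
  have hk1 : (((k + 1)! : ℕ) : ℂ) ≠ 0 := by exact_mod_cast (Nat.factorial_pos (k + 1)).ne'
  simp only [phiK]
  rw [expTrunc_succ, Nat.factorial_succ]
  push_cast
  field_simp
  ring

/-- **Integral form**: for `z ≠ 0`, `Φ_k(z) = (-1)^k ∫_0^1 x^k e^{zx} dx`. [folklore] -/
theorem phiK_eq_integral {z : ℂ} (hz : z ≠ 0) (k : ℕ) :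
    phiK k z = (-1) ^ k * ∫ x in (0 : ℝ)..1, (x : ℂ) ^ k * Complex.exp (z * x) := by
  induction k with
  | zero =>
    rw [phiK_zero]
    simp only [pow_zero, one_mul]
    rw [integral_exp_mul_complex hz]
    simp
  | succ k ih =>
    -- integration by parts: `∫_0^1 x^{k+1} e^{zx} = e^z/z - ((k+1)/z) ∫_0^1 x^k e^{zx}`
    have hu : ∀ x ∈ Set.uIcc (0 : ℝ) 1, HasDerivAt (fun x : ℝ ↦ (x : ℂ) ^ (k + 1))
        (((k : ℂ) + 1) * (x : ℂ) ^ k) x := by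
      intro x _
      have h := (hasDerivAt_pow (k + 1) (x : ℂ)).comp_ofReal
      simp only [Nat.add_sub_cancel] at h
      refine h.congr_deriv ?_
      push_cast; ring
    have hv : ∀ x ∈ Set.uIcc (0 : ℝ) 1, HasDerivAt (fun x : ℝ ↦ Complex.exp (z * x) / z)
        (Complex.exp (z * x)) x := by
      intro x _
      have h1 : HasDerivAt (fun y : ℂ ↦ Complex.exp (z * y) / z) (Complex.exp (z * x)) (x : ℂ) := by
        have := ((Complex.hasDerivAt_exp (z * x)).comp (x : ℂ) ((hasDerivAt_id (x : ℂ)).const_mul z)).div_const z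
        refine this.congr_deriv ?_
        field_simp
      exact h1.comp_ofReal
    have hparts := intervalIntegral.integral_mul_deriv_eq_deriv_mul hu hv
      ((by fun_prop : Continuous fun x : ℝ ↦ ((k : ℂ) + 1) * (x : ℂ) ^ k).intervalIntegrable 0 1)
      ((by fun_prop : Continuous fun x : ℝ ↦ Complex.exp (z * x)).intervalIntegrable 0 1)
    -- `hparts : ∫ x^{k+1} e^{zx} = 1 * e^z/z - 0 - ∫ (k+1) x^k e^{zx}/z`
    have e1 : ∫ x in (0 : ℝ)..1, ((k : ℂ) + 1) * (x : ℂ) ^ k * (Complex.exp (z * x) / z) =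
        ((k : ℂ) + 1) / z * ∫ x in (0 : ℝ)..1, (x : ℂ) ^ k * Complex.exp (z * x) := by
      rw [← intervalIntegral.integral_const_mul]
      exact intervalIntegral.integral_congr fun x _ ↦ by ring
    rw [e1] at hparts
    -- solve the recurrence
    have hrec := mul_phiK_succ hz k
    rw [ih] at hrec
    have hI : ∫ x in (0 : ℝ)..1, (x : ℂ) ^ (k + 1) * Complex.exp (z * x) =
        Complex.exp z / z - ((k : ℂ) + 1) / z * ∫ x in (0 : ℝ)..1, (x : ℂ) ^ k * Complex.exp (z * x) := by
      rw [hparts]; simp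
    rw [hI]
    rw [← mul_right_inj' hz]
    rw [hrec]
    field_simp
    ring

/-- `‖Φ_k(iy)‖ ≤ 1/(k+1)` (from the integral form; the junk value at `y = 0` is `0`). [folklore] -/
theorem norm_phiK_I_le (k : ℕ) (y : ℝ) : ‖phiK k (y * I)‖ ≤ 1 / (k + 1) := by
  by_cases hy : y = 0
  · subst hy
    simp [phiK]
    positivity
  have hz : (y : ℂ) * I ≠ 0 := mul_ne_zero (ofReal_ne_zero.2 hy) I_ne_zero
  rw [phiK_eq_integral hz, norm_mul, norm_pow, norm_neg, norm_one, one_pow, one_mul]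
  calc ‖∫ x in (0 : ℝ)..1, (x : ℂ) ^ k * Complex.exp ((y : ℂ) * I * x)‖
      ≤ ∫ x in (0 : ℝ)..1, ‖(x : ℂ) ^ k * Complex.exp ((y : ℂ) * I * x)‖ :=
        intervalIntegral.norm_integral_le_integral_norm zero_le_one
    _ = ∫ x in (0 : ℝ)..1, x ^ k := by
        refine intervalIntegral.integral_congr fun x hx ↦ ?_
        rw [Set.uIcc_of_le zero_le_one] at hx
        rw [norm_mul, norm_pow, Complex.norm_real, Real.norm_of_nonneg hx.1,
          show (y : ℂ) * I * x = ((y * x : ℝ) : ℂ) * I by push_cast; ring, norm_exp_ofReal_mul_I,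
          mul_one]
    _ = 1 / (k + 1) := by rw [integral_pow]; simp

/-- `‖Φ_k(iy)‖ ≤ 2/|y|` (one integration by parts, here through the recurrence). [folklore] -/
theorem norm_phiK_I_le_div (k : ℕ) {y : ℝ} (hy : y ≠ 0) : ‖phiK k (y * I)‖ ≤ 2 / |y| := by
  have hz : (y : ℂ) * I ≠ 0 := mul_ne_zero (ofReal_ne_zero.2 hy) I_ne_zero
  have hny : ‖(y : ℂ) * I‖ = |y| := by rw [norm_mul, norm_I, mul_one, norm_real, Real.norm_eq_abs]
  have hy' : 0 < |y| := abs_pos.2 hy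
  rw [le_div_iff₀ hy', ← hny, ← norm_mul, mul_comm]
  cases k with
  | zero =>
    rw [phiK_zero, mul_div_cancel₀ _ hz]
    calc ‖Complex.exp (y * I) - 1‖ ≤ ‖Complex.exp (y * I)‖ + ‖(1 : ℂ)‖ := norm_sub_le _ _
      _ = 2 := by rw [norm_exp_ofReal_mul_I, norm_one]; norm_num
  | succ k =>
    rw [mul_phiK_succ hz]
    calc ‖((k : ℂ) + 1) * phiK k (y * I) + (-1) ^ (k + 1) * Complex.exp (y * I)‖
        ≤ ‖((k : ℂ) + 1) * phiK k (y * I)‖ + ‖(-1 : ℂ) ^ (k + 1) * Complex.exp (y * I)‖ := norm_add_le _ _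
      _ ≤ 1 + 1 := by
          gcongr
          · rw [norm_mul, show ((k : ℂ) + 1) = ((k + 1 : ℝ) : ℂ) by push_cast; ring, norm_real,
              Real.norm_of_nonneg (by positivity)]
            have := norm_phiK_I_le k y
            calc (k + 1 : ℝ) * ‖phiK k (y * I)‖ ≤ (k + 1) * (1 / (k + 1)) := by gcongr
              _ = 1 := by field_simp
          · rw [norm_mul, norm_pow, norm_neg, norm_one, one_pow, one_mul, norm_exp_ofReal_mul_I]
      _ = 2 := by norm_num

/-- **The envelope bound `‖Φ_k(iy)‖ ≤ min 1 (2/|y|)`** (for `y ≠ 0`). [folklore] -/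
theorem norm_phiK_I_le_min (k : ℕ) {y : ℝ} (hy : y ≠ 0) : ‖phiK k (y * I)‖ ≤ min 1 (2 / |y|) := by
  refine le_min ((norm_phiK_I_le k y).trans ?_) (norm_phiK_I_le_div k hy)
  rw [div_le_one (by positivity)]; linarith [k.cast_nonneg (α := ℝ)]

/-- Continuity of `Φ_k` away from `0`. [folklore] -/
theorem continuousAt_phiK (k : ℕ) {z : ℂ} (hz : z ≠ 0) : ContinuousAt (phiK k) z := by
  unfold phiK expTrunc
  refine ContinuousAt.div (by fun_prop) (by fun_prop) (pow_ne_zero _ hz)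

/-- Measurability of `Φ_k`. [folklore] -/
theorem measurable_phiK (k : ℕ) : Measurable (phiK k) := by
  unfold phiK expTrunc
  refine Measurable.div (by fun_prop) (by fun_prop)

/-! ## 2. Iterated `dslope`: exact Taylor expansions with an analytic remainder -/

/-- `dsl f a n = (swap dslope a)^[n] f`, the `n`-th iterated divided difference of `f` at `a`.
[folklore] -/
def dsl (f : ℂ → ℂ) (a : ℂ) (n : ℕ) : ℂ → ℂ :=
  (Function.swap dslope a)^[n] f

/-- `dsl f a 0 = f`. [folklore] -/
theorem dsl_zero (f : ℂ → ℂ) (a : ℂ) : dsl f a 0 = f := rfl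

/-- `dsl f a (n+1) = dslope (dsl f a n) a`. [folklore] -/
theorem dsl_succ (f : ℂ → ℂ) (a : ℂ) (n : ℕ) : dsl f a (n + 1) = dslope (dsl f a n) a := by
  rw [dsl, Function.iterate_succ']
  rfl

/-- **Exact Taylor expansion through iterated divided differences**:
`f(s) = ∑_{j<n} (dsl f a j)(a) (s-a)^j + (s-a)^n (dsl f a n)(s)` for every `s`. [folklore] -/
theorem taylor_dsl (f : ℂ → ℂ) (a : ℂ) (n : ℕ) (s : ℂ) :
    f s = ∑ j ∈ Finset.range n, dsl f a j a * (s - a) ^ j + (s - a) ^ n * dsl f a n s := by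
  induction n with
  | zero => simp [dsl_zero]
  | succ n ih =>
    rw [Finset.sum_range_succ, dsl_succ, pow_succ]
    have h := sub_smul_dslope (dsl f a n) a s
    rw [smul_eq_mul] at h
    have e : dsl f a n s = dsl f a n a + (s - a) * dslope (dsl f a n) a s := by rw [h]; ring
    rw [ih, e]
    ring

/-- `dslope` of a function analytic on a set is analytic there. [folklore] -/
theorem analyticOnNhd_dslope {f : ℂ → ℂ} {U : Set ℂ} (hf : AnalyticOnNhd ℂ f U) (a : ℂ) :
    AnalyticOnNhd ℂ (dslope f a) U := by
  intro b hb
  rcases eq_or_ne b a with rfl | hne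
  · obtain ⟨p, hp⟩ := hf b hb
    exact hp.has_fpower_series_dslope_fslope.analyticAt
  · have han : AnalyticAt ℂ (fun z ↦ (z - a)⁻¹ • (f z - f a)) b :=
      ((analyticAt_id.sub analyticAt_const).inv (sub_ne_zero.2 hne)).smul
        ((hf b hb).sub analyticAt_const)
    refine han.congr ?_
    filter_upwards [isOpen_ne.mem_nhds hne] with z hz
    rw [dslope_of_ne f hz, slope_def_module]

/-- Iterated divided differences of an analytic function are analytic. [folklore] -/
theorem analyticOnNhd_dsl {f : ℂ → ℂ} {U : Set ℂ} (hf : AnalyticOnNhd ℂ f U) (a : ℂ) (n : ℕ) :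
    AnalyticOnNhd ℂ (dsl f a n) U := by
  induction n with
  | zero => exact hf
  | succ n ih => rw [dsl_succ]; exact analyticOnNhd_dslope ih a

/-- If `f` is analytic near `a` and `f = (z-a)^n g` near `a` with `g` continuous at `a`, then the
divided differences `(dsl f a j)(a)` vanish for `j < n`. [folklore] -/
theorem dsl_apply_self_eq_zero {f : ℂ → ℂ} {U : Set ℂ} (hf : AnalyticOnNhd ℂ f U) {a : ℂ}
    (ha : a ∈ U) {n : ℕ} {g : ℂ → ℂ} (hg : ContinuousAt g a)
    (h : ∀ᶠ z in 𝓝 a, f z = (z - a) ^ n * g z) : ∀ j, j < n → dsl f a j a = 0 := by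
  intro j
  induction j using Nat.strong_induction_on with
  | _ j IH =>
    intro hj
    have hcont : ContinuousAt (dsl f a j) a := (analyticOnNhd_dsl hf a j a ha).continuousAt
    have h1 : Tendsto (dsl f a j) (𝓝[≠] a) (𝓝 (dsl f a j a)) :=
      hcont.tendsto.mono_left nhdsWithin_le_nhds
    have h2 : Tendsto (fun s ↦ (s - a) ^ (n - j) * g s) (𝓝[≠] a) (𝓝 0) := by
      have hc : ContinuousAt (fun s : ℂ ↦ (s - a) ^ (n - j) * g s) a :=
        ((continuousAt_id.sub continuousAt_const).pow _).mul hg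
      have := hc.tendsto
      simp only [sub_self, zero_pow (Nat.sub_ne_zero_of_lt hj), zero_mul] at this
      exact this.mono_left nhdsWithin_le_nhds
    have heq : (dsl f a j) =ᶠ[𝓝[≠] a] fun s ↦ (s - a) ^ (n - j) * g s := by
      have h' : ∀ᶠ s in 𝓝[≠] a, f s = (s - a) ^ n * g s ∧ s ≠ a :=
        (h.filter_mono nhdsWithin_le_nhds).and self_mem_nhdsWithin
      filter_upwards [h'] with s ⟨hs, hne⟩
      have ht := taylor_dsl f a j s
      rw [Finset.sum_eq_zero (fun i hi ↦ by rw [IH i (Finset.mem_range.1 hi)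
        ((Finset.mem_range.1 hi).trans hj), zero_mul]), zero_add] at ht
      have hsa : (s - a) ^ j ≠ 0 := pow_ne_zero _ (sub_ne_zero.2 hne)
      apply mul_left_cancel₀ hsa
      rw [← ht, hs, ← mul_assoc, ← pow_add, Nat.add_sub_cancel' hj.le]
    exact tendsto_nhds_unique (h1.congr' heq) h2

/-- Under the same hypotheses, `(dsl f a n)(s) = f(s)/(s-a)^n` off `a`. [folklore] -/
theorem dsl_eq_div {f : ℂ → ℂ} {U : Set ℂ} (hf : AnalyticOnNhd ℂ f U) {a : ℂ} (ha : a ∈ U)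
    {n : ℕ} {g : ℂ → ℂ} (hg : ContinuousAt g a) (h : ∀ᶠ z in 𝓝 a, f z = (z - a) ^ n * g z)
    {s : ℂ} (hs : s ≠ a) : dsl f a n s = f s / (s - a) ^ n := by
  have ht := taylor_dsl f a n s
  rw [Finset.sum_eq_zero (fun i hi ↦ by rw [dsl_apply_self_eq_zero hf ha hg h i
    (Finset.mem_range.1 hi), zero_mul]), zero_add] at ht
  have hsa : (s - a) ^ n ≠ 0 := pow_ne_zero _ (sub_ne_zero.2 hs)
  rw [eq_div_iff hsa, ht, mul_comm]

/-! ## 3. The data: `W`, its Taylor polynomial `T_k[W]`, the remainder `Z_k`, and `K_k` -/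

/-- `W_ρ(s) = V(s)/V(ρ)` (unimodular on the critical line, `W_ρ(ρ) = 1`). [cite: Burnol2002, §4] -/
def Wf (ρ s : ℂ) : ℂ :=
  burnolV s / burnolV ρ

/-- The Taylor coefficients `c_j = (dsl W_ρ ρ j)(ρ)` of `W_ρ` at `ρ`. [folklore] -/
def wCoef (ρ : ℂ) (j : ℕ) : ℂ :=
  dsl (Wf ρ) ρ j ρ

/-- The Taylor polynomial `T_k[W_ρ](s) = ∑_{j ≤ k} c_j (s-ρ)^j`. [folklore] -/
def TW (ρ : ℂ) (k : ℕ) (s : ℂ) : ℂ :=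
  ∑ j ∈ Finset.range (k + 1), wCoef ρ j * (s - ρ) ^ j

/-- The remainder `Z_k = dsl W_ρ ρ (k+1)`, so that `W_ρ = T_k[W_ρ] + (s-ρ)^{k+1} Z_k` exactly; it is
analytic in the critical strip and does not depend on `λ`. [folklore] -/
def Zk (ρ : ℂ) (k : ℕ) : ℂ → ℂ :=
  dsl (Wf ρ) ρ (k + 1)

/-- `W_ρ(s) = T_k[W_ρ](s) + (s-ρ)^{k+1} Z_k(s)`. [folklore] -/
theorem Wf_eq_TW_add (ρ : ℂ) (k : ℕ) (s : ℂ) :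
    Wf ρ s = TW ρ k s + (s - ρ) ^ (k + 1) * Zk ρ k s :=
  taylor_dsl (Wf ρ) ρ (k + 1) s

/-- **The `k`-th Mellin-side datum** attached to a zero `ρ` (of multiplicity `> k`) and `λ`:
`K_k(s) = -r(s) · (k! Z_k(s) + W_ρ(s) L^{k+1} Φ_k(L(s-ρ)))`, `L = log(1/λ)`. Equivalently
(`burnolKk_eq_pole_expansion`) `K_k = k! r (T_k[W_ρ] - (V(s)/V(ρ)) λ^{ρ-s} T_k(-L(s-ρ))) / (s-ρ)^{k+1}`,
a finite combination of `r(s)/(s-ρ)^n` and `(V(s)/V(ρ))λ^{ρ-s} r(s)/(s-ρ)^n`, `1 ≤ n ≤ k+1`; for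
`k = 0` it is `-burnolK ρ λ` (`burnolKk_zero`). It is the Mellin transform side (conjugated) of a
variant of Burnol's `Y^λ_{ρ,k} = lim_{w→ρ} V⁻¹Q_λV(ψ_{w,k})`. [cite: Burnol2002, Thm. 4.2 and Definition 5.1] -/
def burnolKk (ρ : ℂ) (k : ℕ) (lam : ℝ) (s : ℂ) : ℂ :=
  -burnolR s * (k ! * Zk ρ k s +
    Wf ρ s * (Lof lam : ℂ) ^ (k + 1) * phiK k ((Lof lam : ℂ) * (s - ρ)))

/-- `λ^{ρ-s} = exp(L(s-ρ))` with `L = -log λ` (`λ > 0`). [folklore] -/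
theorem cpow_rho_sub_eq_exp {lam : ℝ} (hlam : 0 < lam) (ρ s : ℂ) :
    (lam : ℂ) ^ (ρ - s) = Complex.exp ((Lof lam : ℂ) * (s - ρ)) := by
  rw [cpow_def_of_ne_zero (by exact_mod_cast hlam.ne'), ← Complex.ofReal_log hlam.le, Lof]
  congr 1
  push_cast
  ring

/-- **Pole expansion form of `K_k`** (`0 < λ < 1`, `s ≠ ρ`):
`K_k(s) = k! r(s) (T_k[W_ρ](s) - (V(s)/V(ρ)) λ^{ρ-s} T_k(-L(s-ρ))) / (s-ρ)^{k+1}`. [folklore] -/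
theorem burnolKk_eq_pole_expansion {lam : ℝ} (h0 : 0 < lam) (h1 : lam < 1) (ρ : ℂ) (k : ℕ) {s : ℂ}
    (hs : s ≠ ρ) :
    burnolKk ρ k lam s = k ! * burnolR s *
      (TW ρ k s - burnolV s / burnolV ρ * (lam : ℂ) ^ (ρ - s) *
        expTrunc k (-((Lof lam : ℂ) * (s - ρ)))) / (s - ρ) ^ (k + 1) := by
  have hL : (Lof lam : ℂ) ≠ 0 := by exact_mod_cast (Lof_pos h0 h1).ne'
  have hsρ : (s - ρ) ^ (k + 1) ≠ 0 := pow_ne_zero _ (sub_ne_zero.2 hs)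
  have hZ : Zk ρ k s = (Wf ρ s - TW ρ k s) / (s - ρ) ^ (k + 1) := by
    rw [eq_div_iff hsρ, Wf_eq_TW_add ρ k s]; ring
  rw [burnolKk, hZ, phiK, cpow_rho_sub_eq_exp h0, Wf, mul_pow]
  field_simp
  ring

/-- `T_0[W_ρ] = 1` (`V(ρ) ≠ 0`). [folklore] -/
theorem TW_zero {ρ : ℂ} (hV : burnolV ρ ≠ 0) (s : ℂ) : TW ρ 0 s = 1 := by
  simp [TW, wCoef, dsl_zero, Wf, div_self hV]

/-- **`K_0 = -burnolK`** (off `s = ρ`, `0 < λ < 1`, `0 < re ρ < 1`): the `k = 0` datum is the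
tree's `k = 0` vector up to sign. [folklore] -/
theorem burnolKk_zero {lam : ℝ} (h0 : 0 < lam) (h1 : lam < 1) {ρ : ℂ} (hρ0 : 0 < ρ.re)
    (hρ1 : ρ.re < 1) {s : ℂ} (hs : s ≠ ρ) :
    burnolKk ρ 0 lam s = -burnolK ρ lam s := by
  have hV := burnolV_ne_zero hρ0 hρ1
  rw [burnolKk_eq_pole_expansion h0 h1 ρ 0 hs, TW_zero hV, burnolK]
  simp [expTrunc]
  ring

/-! ## 4. Bounds on the critical line -/

/-- `|W_ρ| = 1` on the critical line (for `ρ` on the line). [folklore] -/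
theorem norm_Wf_line (γ τ : ℝ) : ‖Wf ((1 / 2 : ℂ) + γ * I) ((1 / 2 : ℂ) + τ * I)‖ = 1 := by
  rw [Wf, norm_div, norm_burnolV_line, norm_burnolV_line, div_one]

/-- `W_ρ` is analytic on the open strip `1/4 < re s < 3/4`. [folklore] -/
theorem analyticOnNhd_Wf (ρ : ℂ) :
    AnalyticOnNhd ℂ (Wf ρ) {z : ℂ | 1 / 4 < z.re ∧ z.re < 3 / 4} := by
  have hUo : IsOpen {z : ℂ | 1 / 4 < z.re ∧ z.re < 3 / 4} :=
    (isOpen_lt continuous_const continuous_re).inter (isOpen_lt continuous_re continuous_const)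
  refine DifferentiableOn.analyticOnNhd (fun z hz ↦ ?_) hUo
  exact ((differentiableAt_burnolV (by linarith [hz.1]) (by linarith [hz.2])).div_const
    (burnolV ρ)).differentiableWithinAt

/-- `Z_k` is analytic on the open strip `1/4 < re s < 3/4`. [folklore] -/
theorem analyticOnNhd_Zk (ρ : ℂ) (k : ℕ) :
    AnalyticOnNhd ℂ (Zk ρ k) {z : ℂ | 1 / 4 < z.re ∧ z.re < 3 / 4} :=
  analyticOnNhd_dsl (analyticOnNhd_Wf ρ) ρ (k + 1)

/-- Points of the critical line lie in the strip `1/4 < re s < 3/4`. [folklore] -/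
lemma line_mem_strip (τ : ℝ) : (1 / 2 : ℂ) + τ * I ∈ {z : ℂ | 1 / 4 < z.re ∧ z.re < 3 / 4} := by
  constructor <;> simp <;> norm_num

/-- `Z_k` is continuous along the critical line. [folklore] -/
theorem continuous_Zk_line (γ : ℝ) (k : ℕ) :
    Continuous fun τ : ℝ ↦ Zk ((1 / 2 : ℂ) + γ * I) k ((1 / 2 : ℂ) + τ * I) := by
  have hline : Continuous fun τ : ℝ ↦ (1 / 2 : ℂ) + τ * I := by fun_prop
  refine continuous_iff_continuousAt.2 fun τ ↦ ?_
  have h1 : ContinuousAt (Zk ((1 / 2 : ℂ) + γ * I) k) ((1 / 2 : ℂ) + τ * I) :=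
    (analyticOnNhd_Zk _ k _ (line_mem_strip τ)).continuousAt
  exact ContinuousAt.comp (g := Zk ((1 / 2 : ℂ) + γ * I) k) h1 hline.continuousAt

/-- `W_ρ` is continuous along the critical line. [folklore] -/
theorem continuous_Wf_line (ρ : ℂ) : Continuous fun τ : ℝ ↦ Wf ρ ((1 / 2 : ℂ) + τ * I) :=
  continuous_burnolV_line.div_const _

/-- **`Z_k` is bounded on the critical line**: there is `D ≥ 0` with `‖Z_k(1/2+iτ)‖ ≤ D` for all
`τ` (continuity near `γ`; the formula `Z_k = (W - T_k[W])/(s-ρ)^{k+1}` with `|W| = 1` away from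
`γ`). [folklore] -/
theorem exists_norm_Zk_line_le (γ : ℝ) (k : ℕ) :
    ∃ D : ℝ, 0 ≤ D ∧ ∀ τ : ℝ, ‖Zk ((1 / 2 : ℂ) + γ * I) k ((1 / 2 : ℂ) + τ * I)‖ ≤ D := by
  set ρ : ℂ := (1 / 2 : ℂ) + γ * I with hρ
  -- near `γ`: continuity on the compact interval `[γ - 1, γ + 1]`
  obtain ⟨C, hC⟩ := (isCompact_Icc (a := γ - 1) (b := γ + 1)).exists_bound_of_continuousOn
    (continuous_Zk_line γ k).continuousOn
  -- away from `γ`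
  set B : ℝ := 1 + ∑ j ∈ Finset.range (k + 1), ‖wCoef ρ j‖ with hB
  have hB0 : 0 ≤ B := by positivity
  have hC0 : 0 ≤ C := (norm_nonneg _).trans (hC γ ⟨by linarith, by linarith⟩)
  refine ⟨max C B, le_max_of_le_left hC0, fun τ ↦ ?_⟩
  by_cases hτ : |τ - γ| ≤ 1
  · have hmem : τ ∈ Set.Icc (γ - 1) (γ + 1) := by
      constructor <;> linarith [(abs_le.1 hτ).1, (abs_le.1 hτ).2]
    exact (hC τ hmem).trans (le_max_left _ _)
  · rw [not_le] at hτ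
    refine le_trans ?_ (le_max_right _ _)
    set s : ℂ := (1 / 2 : ℂ) + τ * I with hs
    have hu : ‖s - ρ‖ = |τ - γ| := norm_line_sub_line τ γ
    have hu1 : 1 ≤ ‖s - ρ‖ := by rw [hu]; exact hτ.le
    have hsρ : (s - ρ) ^ (k + 1) ≠ 0 := by
      refine pow_ne_zero _ (norm_ne_zero_iff.1 ?_); linarith
    have hZ : Zk ρ k s = (Wf ρ s - TW ρ k s) / (s - ρ) ^ (k + 1) := by
      rw [eq_div_iff hsρ, Wf_eq_TW_add ρ k s]; ring
    rw [hZ, norm_div, norm_pow]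
    have hden : 1 ≤ ‖s - ρ‖ ^ (k + 1) := one_le_pow₀ hu1
    rw [div_le_iff₀ (by positivity)]
    calc ‖Wf ρ s - TW ρ k s‖ ≤ ‖Wf ρ s‖ + ‖TW ρ k s‖ := norm_sub_le _ _
      _ ≤ 1 + ∑ j ∈ Finset.range (k + 1), ‖wCoef ρ j‖ * ‖s - ρ‖ ^ j := by
          gcongr
          · exact (norm_Wf_line γ τ).le
          · exact (norm_sum_le _ _).trans (Finset.sum_le_sum fun j _ ↦ by rw [norm_mul, norm_pow])
      _ ≤ 1 * ‖s - ρ‖ ^ (k + 1) + ∑ j ∈ Finset.range (k + 1), ‖wCoef ρ j‖ * ‖s - ρ‖ ^ (k + 1) := by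
          refine add_le_add (by linarith) (Finset.sum_le_sum fun j hj ↦ ?_)
          exact mul_le_mul_of_nonneg_left
            (pow_le_pow_right₀ hu1 (Finset.mem_range.1 hj).le) (norm_nonneg _)
      _ = B * ‖s - ρ‖ ^ (k + 1) := by rw [hB, add_mul, Finset.sum_mul]

/-- The scaled model on the line: `‖L^{k+1} Φ_k(L(s-ρ))‖ ≤ L^{k+1}` and `≤ 2 L^k/|τ-γ|`
(`0 < λ < 1`). [folklore] -/
theorem norm_model_line_le {lam : ℝ} (h0 : 0 < lam) (h1 : lam < 1) (k : ℕ) (γ τ : ℝ) :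
    ‖(Lof lam : ℂ) ^ (k + 1) * phiK k ((Lof lam : ℂ) * (((1 / 2 : ℂ) + τ * I) - ((1 / 2 : ℂ) + γ * I)))‖
        ≤ Lof lam ^ (k + 1) ∧
      (τ ≠ γ → ‖(Lof lam : ℂ) ^ (k + 1) *
          phiK k ((Lof lam : ℂ) * (((1 / 2 : ℂ) + τ * I) - ((1 / 2 : ℂ) + γ * I)))‖ ≤
        2 * Lof lam ^ k / |τ - γ|) := by
  have hL := Lof_pos h0 h1
  have e : (Lof lam : ℂ) * (((1 / 2 : ℂ) + τ * I) - ((1 / 2 : ℂ) + γ * I)) =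
      ((Lof lam * (τ - γ) : ℝ) : ℂ) * I := by push_cast; ring
  have hnL : ‖(Lof lam : ℂ) ^ (k + 1)‖ = Lof lam ^ (k + 1) := by
    rw [norm_pow, norm_real, Real.norm_of_nonneg hL.le]
  rw [e, norm_mul, hnL]
  constructor
  · calc Lof lam ^ (k + 1) * ‖phiK k (((Lof lam * (τ - γ) : ℝ) : ℂ) * I)‖
        ≤ Lof lam ^ (k + 1) * (1 / (k + 1)) := by gcongr; exact norm_phiK_I_le k _
      _ ≤ Lof lam ^ (k + 1) * 1 := by
          gcongr; rw [div_le_one (by positivity)]; linarith [k.cast_nonneg (α := ℝ)]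
      _ = Lof lam ^ (k + 1) := mul_one _
  · intro hτ
    have hy : Lof lam * (τ - γ) ≠ 0 := mul_ne_zero hL.ne' (sub_ne_zero.2 hτ)
    calc Lof lam ^ (k + 1) * ‖phiK k (((Lof lam * (τ - γ) : ℝ) : ℂ) * I)‖
        ≤ Lof lam ^ (k + 1) * (2 / |Lof lam * (τ - γ)|) := by
          gcongr; exact norm_phiK_I_le_div k hy
      _ = 2 * Lof lam ^ k / |τ - γ| := by
          rw [abs_mul, abs_of_pos hL, pow_succ]
          field_simp

/-- **Pointwise bound for `K_k` on the line** (`0 < λ < 1`, `D` a bound for `Z_k`):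
`‖K_k(1/2+iτ)‖ ≤ ‖r(1/2+iτ)‖ (k! D + L^{k+1})` and, for `τ ≠ γ`,
`‖K_k(1/2+iτ)‖ ≤ ‖r(1/2+iτ)‖ (k! D + 2L^k/|τ-γ|)`. [folklore] -/
theorem norm_burnolKk_line_le {lam : ℝ} (h0 : 0 < lam) (h1 : lam < 1) {γ : ℝ} {k : ℕ} {D : ℝ}
    (hD : ∀ τ : ℝ, ‖Zk ((1 / 2 : ℂ) + γ * I) k ((1 / 2 : ℂ) + τ * I)‖ ≤ D) (τ : ℝ) :
    ‖burnolKk ((1 / 2 : ℂ) + γ * I) k lam ((1 / 2 : ℂ) + τ * I)‖ ≤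
        ‖burnolR ((1 / 2 : ℂ) + τ * I)‖ * (k ! * D + Lof lam ^ (k + 1)) ∧
      (τ ≠ γ → ‖burnolKk ((1 / 2 : ℂ) + γ * I) k lam ((1 / 2 : ℂ) + τ * I)‖ ≤
        ‖burnolR ((1 / 2 : ℂ) + τ * I)‖ * (k ! * D + 2 * Lof lam ^ k / |τ - γ|)) := by
  obtain ⟨hm1, hm2⟩ := norm_model_line_le h0 h1 k γ τ
  have hZ := hD τ
  have hW := norm_Wf_line γ τ
  have key : ∀ {M : ℝ}, ‖(Lof lam : ℂ) ^ (k + 1) *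
      phiK k ((Lof lam : ℂ) * (((1 / 2 : ℂ) + τ * I) - ((1 / 2 : ℂ) + γ * I)))‖ ≤ M →
      ‖burnolKk ((1 / 2 : ℂ) + γ * I) k lam ((1 / 2 : ℂ) + τ * I)‖ ≤
        ‖burnolR ((1 / 2 : ℂ) + τ * I)‖ * (k ! * D + M) := by
    intro M hM
    rw [burnolKk, norm_mul, norm_neg]
    gcongr
    calc ‖(k ! : ℂ) * Zk ((1 / 2 : ℂ) + γ * I) k ((1 / 2 : ℂ) + τ * I) +
          Wf ((1 / 2 : ℂ) + γ * I) ((1 / 2 : ℂ) + τ * I) * (Lof lam : ℂ) ^ (k + 1) *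
            phiK k ((Lof lam : ℂ) * (((1 / 2 : ℂ) + τ * I) - ((1 / 2 : ℂ) + γ * I)))‖
        ≤ ‖(k ! : ℂ) * Zk ((1 / 2 : ℂ) + γ * I) k ((1 / 2 : ℂ) + τ * I)‖ +
          ‖Wf ((1 / 2 : ℂ) + γ * I) ((1 / 2 : ℂ) + τ * I) * (Lof lam : ℂ) ^ (k + 1) *
            phiK k ((Lof lam : ℂ) * (((1 / 2 : ℂ) + τ * I) - ((1 / 2 : ℂ) + γ * I)))‖ :=
          norm_add_le _ _
      _ ≤ k ! * D + M := by
          gcongr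
          · rw [norm_mul, Complex.norm_natCast]; gcongr
          · rw [mul_assoc, norm_mul, hW, one_mul]; exact hM
  exact ⟨key hm1, fun hτ ↦ key (hm2 hτ)⟩

/-- Measurability of `τ ↦ K_k(1/2+iτ)`. [folklore] -/
theorem measurable_burnolKk_line (γ : ℝ) (k : ℕ) (lam : ℝ) :
    Measurable fun τ : ℝ ↦ burnolKk ((1 / 2 : ℂ) + γ * I) k lam ((1 / 2 : ℂ) + τ * I) := by
  unfold burnolKk
  refine (continuous_burnolR_line.measurable.neg).mul ((Measurable.const_mul
    (continuous_Zk_line γ k).measurable _).add (Measurable.mul (Measurable.mul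
    (continuous_Wf_line _).measurable measurable_const) ((measurable_phiK k).comp (by fun_prop))))

/-- **`K_k ∈ L¹ ∩ L²` on the critical line** (`0 < λ < 1`). [folklore] -/
theorem integrable_burnolKk_line {lam : ℝ} (h0 : 0 < lam) (h1 : lam < 1) (γ : ℝ) (k : ℕ) :
    Integrable (fun τ : ℝ ↦ burnolKk ((1 / 2 : ℂ) + γ * I) k lam ((1 / 2 : ℂ) + τ * I)) ∧
      MemLp (fun τ : ℝ ↦ burnolKk ((1 / 2 : ℂ) + γ * I) k lam ((1 / 2 : ℂ) + τ * I)) 2 := by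
  obtain ⟨D, hD0, hD⟩ := exists_norm_Zk_line_le γ k
  refine integrable_and_memLp_two_of_norm_le (C := (k ! * D + Lof lam ^ (k + 1)) * 8)
    (measurable_burnolKk_line γ k lam) fun τ ↦ ?_
  calc ‖burnolKk ((1 / 2 : ℂ) + γ * I) k lam ((1 / 2 : ℂ) + τ * I)‖
      ≤ ‖burnolR ((1 / 2 : ℂ) + τ * I)‖ * (k ! * D + Lof lam ^ (k + 1)) :=
        (norm_burnolKk_line_le h0 h1 hD τ).1
    _ ≤ (8 * (1 + τ ^ 2)⁻¹) * (k ! * D + Lof lam ^ (k + 1)) :=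
        mul_le_mul_of_nonneg_right (norm_burnolR_line_le_inv τ)
          (add_nonneg (mul_nonneg (by positivity) hD0) (pow_nonneg (Lof_pos h0 h1).le _))
    _ = (k ! * D + Lof lam ^ (k + 1)) * 8 * (1 + τ ^ 2)⁻¹ := by ring


/-! ## 5. Kernels of the orthogonality argument (general pole order `n`) -/

/-- `h_{R,n}(s) = θ^s · (dsl ζ₁ ρ n)(s) / s⁵` (`= θ^s ζ₁(s)/(s⁵(s-ρ)^n)` off `ρ` when `n ≤ m(ρ)`).
[cite: Burnol2002, Thm. 4.2 (proof)] -/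
def partRn (θ : ℝ) (ρ : ℂ) (n : ℕ) (s : ℂ) : ℂ :=
  (θ : ℂ) ^ s * dsl riemannZeta₁ ρ n s / s ^ 5

/-- The rational kernel `q_{R,n}(s) = (s-1)/(s⁵(s-ρ)^n)`. [folklore] -/
def qRn (ρ : ℂ) (n : ℕ) (s : ℂ) : ℂ :=
  (s - 1) / (s ^ 5 * (s - ρ) ^ n)

/-- `h_{L,n}(s) = y^s · (-1)^n (dsl ζ₁ (1-ρ) n)(1-s) / (s-1)⁵` (`= y^s ζ₁(1-s)/((s-1)⁵(s-ρ)^n)` off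
`ρ` when `n ≤ m(1-ρ)`). [cite: Burnol2002, Thm. 4.2 (proof)] -/
def partLn (yv : ℝ) (ρ : ℂ) (n : ℕ) (s : ℂ) : ℂ :=
  (yv : ℂ) ^ s * ((-1) ^ n * dsl riemannZeta₁ (1 - ρ) n (1 - s)) / (s - 1) ^ 5

/-- The rational kernel `q_{L,n}(s) = s/((s-1)⁵(s-ρ)^n)` of the left part. [folklore] -/
def qLn (ρ : ℂ) (n : ℕ) (s : ℂ) : ℂ :=
  s / ((s - 1) ^ 5 * (s - ρ) ^ n)


/-! ## 6. The scaled model on the line, the monomials `𝟙_{[0,1]} x^k` and the Gram kernel -/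

/-- The scaled model on the line: `M_k(λ; γ, τ) = L^{k+1} Φ_k(L(s-ρ))`, `s = 1/2+iτ`, `ρ = 1/2+iγ`,
`L = log(1/λ)`; it equals `(-1)^k ∫_0^L y^k e^{(s-ρ)y} dy` (`Mk_eq_integral`). [cite: Burnol2002, Thm. 5.2 (proof)] -/
def Mk (k : ℕ) (lam γ τ : ℝ) : ℂ :=
  (Lof lam : ℂ) ^ (k + 1) * phiK k ((Lof lam : ℂ) * (((1 / 2 : ℂ) + τ * I) - ((1 / 2 : ℂ) + γ * I)))

/-- `f_k = 𝟙_{[0,1]} x^k`. [folklore] -/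
def fMon (k : ℕ) : ℝ → ℂ :=
  (Icc (0 : ℝ) 1).indicator fun x : ℝ ↦ (x : ℂ) ^ k

/-- The Gram kernel of the models, `G_{kl}(y) = conj(Φ_k(iy)) Φ_l(iy)`. [folklore] -/
def gramKer (k l : ℕ) (y : ℝ) : ℂ :=
  conj (phiK k (y * I)) * phiK l (y * I)


/-! ## 7. The vectors `X^λ_{ρ,k}` (Mellin-side variant of Burnol's Definition 5.1) -/

/-- The line datum of the `k`-th vector attached to the ordinate `γ`: `F(s) = conj(K_k(s))`
(`K_k = burnolKk (1/2+iγ) k λ`). [cite: Burnol2002, Definition 5.1] -/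
def burnolLineDatum (γ : ℝ) (k : ℕ) (lam : ℝ) (s : ℂ) : ℂ :=
  conj (burnolKk ((1 / 2 : ℂ) + γ * I) k lam s)

/-- The unnormalised vector `v = 𝓜⁻¹(conj ∘ K_k) ∈ L²(0,∞)`. [cite: Burnol2002, Definition 5.1] -/
def burnolVec (γ : ℝ) (k : ℕ) (lam : ℝ) : ℝ → ℂ :=
  mellinInv (1 / 2) (burnolLineDatum γ k lam)

/-- The unimodular phase `ε_ρ = -conj(ρ)³/‖ρ‖³` normalising the `k = 0` pairing. [folklore] -/
def burnolPhase (ρ : ℂ) : ℂ :=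
  -(conj ρ) ^ 3 / ((‖ρ‖ ^ 3 : ℝ) : ℂ)

/-- The normalisation `c = ε_ρ (-1)^k / (√w(γ) · L^k · √L)` (`w(γ) = |r(ρ)|²`, `L = log(1/λ)`;
Burnol's `X = L^{-1/2-k} Y`). [cite: Burnol2002, Definition 5.1] -/
def burnolCoef (ρ : ℂ) (k : ℕ) (lam : ℝ) : ℂ :=
  burnolPhase ρ * (-1) ^ k / ((Real.sqrt (wR ρ.im) : ℂ) * (Lof lam : ℂ) ^ k * (Real.sqrt (Lof lam) : ℂ))

/-- **The vectors `X^λ_{ρ,k}`** (a variant of Burnol's, Definition 5.1): `X = c · 𝓜⁻¹(conj ∘ K_k)`.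
[cite: Burnol2002, Definition 5.1] -/
def burnolX (lam : ℝ) (ρ : ℂ) (k : ℕ) (t : ℝ) : ℂ :=
  burnolCoef ρ k lam * burnolVec ρ.im k lam t

end BurnolVectors

end Literature.NumberTheory.LFunctions
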